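import Mathlib
import Summits.ValiantsHypothesis.ValiantsHypothesis.Theorems.GrenetZeonTwoDimCoefficientsScalingSeparableCert

/-!
# Crux `GrenetZeon.TwoDimCoefficients` (stmt-ValiantsHypothesis-8062), stub `stub_dualUnipotent`:
# scaling-closure — index-`n` pencils with SQUAREFREE `det(1_m + t·Y)` over `ℂ(z)` obey `n³ ≤ 2m²`

Final form of the 17th hand's ray-interpolation theorem on index-`n` pencils: the function field `ℂ(z)` has characteristic
zero, hence is perfect, so "separable" = "squarefree" (`PerfectField.separable_iff_squarefree`) and
✓ `cube_le_two_mul_sq_of_index_separableFrac` reads: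

* ★★ `cube_le_two_mul_sq_of_index_squarefree` — an index-`n` unipotent dual representation of `per_n`
  (`A = A₀(1 − N)`, `Nⁿ = 0`, `B` affine `m × m`, `det A = c ≠ 0`, `per_n = α·c + β·tr(adj A·B)`, `n ≥ 3`, `m ≥ 2`) whose polynomial
  `c·det(1_m − t·(−c⁻¹P^top))` (`P^top` = degree-`n` part of `adj A·B`; `= Σ_k [D_k]_{kn}t^k`, the scaling-closure shadow on
  rays) is SQUAREFREE over `ℂ(z)` satisfies `n³ ≤ 2m²` — the bound of crux `DualUnipotentThreeHalves` (stmt-24318) with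
  constant `2`, for WILD pencils as well.

The complement — a repeated factor of `det(1_m + t·Y(z))` over `ℂ(z)` — is the exact residual of the method (lemma L1′ of memo
SEVENTEENTH-HAND.md: Mignon–Ressayre for multiple factors at finite `δ`).

HONEST FRAMING: a conditional rung; the stub `DualUnipotentBound`, both cruxes and `VP ≠ VNP` remain open.

References: T. Mignon, N. Ressayre, Int. Math. Res. Not. 2004:79, Thm. 1.1 (via the tree); folklore.
-/

-- single-conjunct layout `Summits/ValiantsHypothesis/ValiantsHypothesis`: the duplicated namespace
-- component is mandated by the tree.
set_option linter.dupNamespace false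
set_option autoImplicit false

noncomputable section

namespace Summit.ValiantsHypothesis.ValiantsHypothesis.Theorems.GrenetZeonTwoDimCoefficients.ScalingClosure

open MvPolynomial Matrix
open Literature.Computability.AlgebraicComplexity
open Summit.ValiantsHypothesis.ValiantsHypothesis.Cruxes.TwoDimCoefficients.DimTwoCases

/-- ★★ **Index-`n` pencils with squarefree `det(1 + t·Y)` obey `n³ ≤ 2m²`** (`n = k + 3`, `m ≥ 2`).
[cite: MignonRessayre2004, Thm. 1.1 — via the tree; folklore] -/
theorem cube_le_two_mul_sq_of_index_squarefree {k m : ℕ} (A B : AffMat (k + 3) m) (hA : IsAffine A)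
    (hB : IsAffine B) (α β c : ℂ) (hc : c ≠ 0) (hβ : β ≠ 0) (hdet : A.det = MvPolynomial.C c)
    (hper : perPoly (Fin (k + 3)) ℂ =
      MvPolynomial.C α * A.det + MvPolynomial.C β * (A.adjugate * B).trace)
    (hm2 : 2 ≤ m) (A₀ P₀ : Matrix (Fin m) (Fin m) ℂ) (hP₀ : A₀ * P₀ = 1) (N : AffMat (k + 3) m)
    (hN : ∀ i j, (N i j).IsHomogeneous 1) (hNn : N ^ (k + 3) = 0) (hAN : A = A₀.map MvPolynomial.C * (1 - N))
    (Ptop : AffMat (k + 3) m) (htop : ∀ i j, Ptop i j = homogeneousComponent (k + 3) ((A.adjugate * B) i j))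
    (hsq : Squarefree (((Polynomial.C (MvPolynomial.C c) *
        (-((MvPolynomial.C c⁻¹ : MvPolynomial (Fin (k + 3) × Fin (k + 3)) ℂ) • Ptop)).charpolyRev).map
        (algebraMap (MvPolynomial (Fin (k + 3) × Fin (k + 3)) ℂ)
          (FractionRing (MvPolynomial (Fin (k + 3) × Fin (k + 3)) ℂ)))))) :
    (k + 3) ^ 3 ≤ 2 * m ^ 2 :=
  cube_le_two_mul_sq_of_index_separableFrac A B hA hB α β c hc hβ hdet hper hm2 A₀ P₀ hP₀ N hN hNn hAN Ptop htop
    (PerfectField.separable_iff_squarefree.mpr hsq)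

end Summit.ValiantsHypothesis.ValiantsHypothesis.Theorems.GrenetZeonTwoDimCoefficients.ScalingClosure

end
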